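import Literature.Probability.RandomPlanarGeometry.LoewnerBoundaryExtension
import Literature.Probability.RandomPlanarGeometry.LoewnerHullBoundaryValues
import Literature.Probability.RandomPlanarGeometry.SLEScaleInvariance
import Literature.Probability.RandomPlanarGeometry.SLEProofs
import Literature.Probability.RandomPlanarGeometry.SLEExistence
import Literature.Probability.RandomPlanarGeometry.ChordalRestrictionMarkov
import Literature.Probability.RandomPlanarGeometry.BoundaryCorrespondence
import Literature.Probability.RandomPlanarGeometry.LoewnerChainProofs
import Literature.Probability.RandomPlanarGeometry.LoewnerCurveLimitDomain
import Literature.Probability.RandomPlanarGeometry.CaratheodoryHalfPlaneProofs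
import HarnessLib

/-!
# The domain-Markov kernel of chordal SLE_κ on explored configurations

Topic `Probability/RandomPlanarGeometry` (definition file; for the typed domain Markov property
`ChordalFamily.IsDomainMarkov` of the family of chordal SLE_κ laws, crux
`stmt-CriticalPhenomena-0698`, line germ-label-transport, stub `stub_isDomainMarkov`).

Werner (2007), §3.2 (2) asks, for a chordal curve family `P`, that conditionally on an explored
initial piece `γ[0, t]` the remainder has law `P_{D_t, γ_t, b}` — the family's law in the slit
domain `D_t`. For the chordal SLE_κ laws this conditional law is (Schramm's conformal Markov
property, Rohde–Schramm (2005), Prop. 2.1 (ii) with the strong Markov property of the driving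
Brownian motion) the image of a FRESH SLE_κ trace under the map
`ψ = Φ ∘ f̄_r(· + W r)` — `Φ` the boundary extension of a chordal uniformizing map of `D`, `f̄_r`
the continuous extension of `g_r⁻¹` (`Loewner.bdryInv`) — compactified with endpoint `b`. This
file DEFINES

* `SLEConfig` — an explored configuration: a Dobrushin domain with a chordal uniformizing map, a
  continuous driving function whose chain is generated by a curve, and a time `r`; its conformal
  parametrisation `SLEConfig.ψ : ℂ → ℂ` of the remaining domain `SLEConfig.dom = Φ '' (ℍ ∖ K_r)`,
  its tip `SLEConfig.tip = Φ (γ r)` and target `SLEConfig.tgt = b`;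
* `sleImageLaw κ ψ b` — the law of the class of the compactified `ψ`-image of the SLE_κ trace
  (`compactifiedClass`, a measurable functional of the path);
* `sleMarkovKernel κ : DobrushinDomain → CurveClass ℂ → Measure (CurveClass ℂ)` — the candidate
  Markov extension: Dirac at the constant curve when the tip is the target; otherwise the image
  law of (a choice of) a configuration realising `(remainingDomain D past, past.target, D.pt 1)`;
  `0` when no configuration realises it;

and proves the `domain` clause of `ChordalFamily.IsMarkovExtension` for it (it is a function of
the triple by construction) and the basic properties of `ψ` (continuity on `ℂ`, the formula on
`ℍₒ`, `ψ 0 = tip`, values never equal to the target, the conformal equivalence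
`SLEConfig.conf : ℍₒ → dom`). Boundary behaviour, scale invariance of the image law and the
`initial` clause are in `SLEMarkovKernelInitial.lean`; the `markov` clause (strong Markov
property at trace hitting times + rigidity) is proved separately.

## References

* W. Werner, *Lectures on two-dimensional critical percolation* (2007), §3.2 (2).
* S. Rohde, O. Schramm, *Basic properties of SLE*, Ann. of Math. 161 (2005), Prop. 2.1.
* G. F. Lawler, *Conformally Invariant Processes in the Plane* (2005), §4.1, §6.2–6.3.
-/

noncomputable section

open Set Filter Topology MeasureTheory ProbabilityTheory Complex
open UpperHalfPlane (upperHalfPlaneSet isOpen_upperHalfPlaneSet)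
open scoped NNReal unitInterval

namespace Literature.Probability.RandomPlanarGeometry

/-! ### The vertical projection onto the closed half-plane -/

/-- The vertical projection `x + i y ↦ x + i max(y, 0)` of `ℂ` onto the closed upper half-plane
(used to extend functions defined on `closure ℍₒ` continuously to all of `ℂ`). [folklore] -/
def projH (w : ℂ) : ℂ := ⟨w.re, max w.im 0⟩

/-- `projH` is continuous. [folklore] -/
theorem continuous_projH : Continuous projH := by
  have h : projH = fun w : ℂ ↦ (w.re : ℂ) + (max w.im 0 : ℝ) * Complex.I := by
    funext w
    apply Complex.ext <;> simp [projH]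
  rw [h]
  fun_prop

/-- `projH` takes values in the closed half-plane. [folklore] -/
theorem projH_im_nonneg (w : ℂ) : 0 ≤ (projH w).im := le_max_right _ _

/-- `projH` is the identity on the closed half-plane. [folklore] -/
theorem projH_of_im_nonneg {w : ℂ} (hw : 0 ≤ w.im) : projH w = w :=
  Complex.ext rfl (max_eq_left hw)

/-! ### Explored configurations -/

/-- An **explored configuration** of chordal SLE: a Dobrushin domain `(D; a, b)` with a chordal
uniformizing map `φ : ℍₒ → D`, a continuous driving function `W` whose Loewner chain is generated
by a curve, and an exploration time `r`. Its remaining domain is `Φ (ℍₒ ∖ K_r)`, its tip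
`Φ (γ r)`. Werner (2007), §3.2 (2) (the slit domain `D_t` and the tip `γ_t`).
[cite: Werner2007, §3.2] -/
structure SLEConfig where
  /-- the Dobrushin domain -/
  D : DobrushinDomain
  /-- a chordal uniformizing map of `D` -/
  φ : ConformalEquiv upperHalfPlaneSet D.carrier
  /-- `φ` has boundary values `a` at `0` and `b` at `∞` -/
  isUnif : D.IsChordalUniformizing φ
  /-- the driving function -/
  W : ℝ≥0 → ℝ
  /-- continuity of the driving function -/
  contW : Continuous W
  /-- the chain of `W` is generated by a curve -/
  gen : ∃ γ, Loewner.IsGeneratedByCurve W γ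
  /-- the exploration time -/
  r : ℝ≥0

namespace SLEConfig

variable (c : SLEConfig)

/-- The generating curve of the configuration's chain. [folklore] -/
def γ : ℝ≥0 → ℂ := Loewner.trace c.W

/-- The generating curve generates the chain. [folklore] -/
theorem isGeneratedByCurve : Loewner.IsGeneratedByCurve c.W c.γ :=
  Loewner.isGeneratedByCurve_trace c.gen

/-- The boundary extension `Φ` of the uniformizing map. [folklore] -/
def Φ : ℂ → ℂ := c.φ.boundaryExtension

/-- The conformal parametrisation of the remaining domain by the half-plane:
`ψ w = Φ (f̄_r (w + W r))`, pre-composed with the vertical projection so that it is defined and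
continuous on all of `ℂ`. [cite: Lawler2005, §6.2 (the curves γˢ)] -/
def ψ (w : ℂ) : ℂ := c.Φ (Loewner.bdryInv c.W c.r (projH w + c.W c.r))

/-- The remaining domain `Φ (ℍₒ ∖ K_r)` of the configuration. [cite: Werner2007, §3.2] -/
def dom : Set ℂ := c.Φ '' (upperHalfPlaneSet \ Loewner.hull c.W c.r)

/-- The tip `Φ (γ r)` of the configuration. [cite: Werner2007, §3.2] -/
def tip : ℂ := c.Φ (c.γ c.r)

/-- The target `b = D.pt 1` of the configuration. [folklore] -/
def tgt : ℂ := c.D.pt 1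

/-- The configuration **realises** the triple `(U, z, b)`: remaining domain `U`, tip `z`,
target `b`. [folklore] -/
def Realises (U : Set ℂ) (z b : ℂ) : Prop := c.dom = U ∧ c.tip = z ∧ c.tgt = b

end SLEConfig

/-! ### The image law and the kernel -/

/-- The **law of the compactified `ψ`-image of the SLE_κ trace** with endpoint `b`: push-forward
of the pre-Wiener measure under `ω ↦ compactifiedClass ψ b (sleTrace κ ω)`.
[cite: Lawler2005, §6.3] -/
def sleImageLaw (κ : ℝ≥0) (ψ : ℂ → ℂ) (b : ℂ) : Measure (CurveClass ℂ) :=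
  Process.preWienerMeasure.map fun ω ↦ compactifiedClass ψ b (sleTrace κ ω)

open Classical in
/-- The **domain-Markov kernel of chordal SLE_κ** on explored configurations `(D, past)`:
the Dirac mass at the constant curve at `b` when the tip `past.target` is the target `b = D.pt 1`;
otherwise the image law of a configuration realising the triple
`(remainingDomain D past, past.target, D.pt 1)` (chosen; all realising configurations give the
same law — proved elsewhere); `0` if there is none. [cite: Werner2007, §3.2] -/
def sleMarkovKernel (κ : ℝ≥0) (D : DobrushinDomain) (past : CurveClass ℂ) :
    Measure (CurveClass ℂ) :=
  if past.target = D.pt 1 then Measure.dirac (CurveClass.mk (Curve.const (D.pt 1)))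
  else if h : ∃ c : SLEConfig, c.Realises (remainingDomain D past) past.target (D.pt 1)
    then sleImageLaw κ h.choose.ψ (D.pt 1) else 0

/-- **The `domain` clause**: the kernel depends on `(D, past)` only through the triple
`(remainingDomain D past, past.target, D.pt 1)`. [cite: Werner2007, §3.2] -/
theorem sleMarkovKernel_domain (κ : ℝ≥0) (D₁ D₂ : DobrushinDomain) (p₁ p₂ : CurveClass ℂ)
    (hU : remainingDomain D₁ p₁ = remainingDomain D₂ p₂) (hz : p₁.target = p₂.target)
    (hb : D₁.pt 1 = D₂.pt 1) :
    sleMarkovKernel κ D₁ p₁ = sleMarkovKernel κ D₂ p₂ := by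
  unfold sleMarkovKernel
  rw [hU, hz, hb]

/-- Value of the kernel when the tip is the target. [folklore] -/
theorem sleMarkovKernel_of_target_eq (κ : ℝ≥0) {D : DobrushinDomain} {past : CurveClass ℂ}
    (h : past.target = D.pt 1) :
    sleMarkovKernel κ D past = Measure.dirac (CurveClass.mk (Curve.const (D.pt 1))) := by
  unfold sleMarkovKernel
  rw [if_pos h]

/-- Value of the kernel at a realised triple (through the chosen configuration). [folklore] -/
theorem sleMarkovKernel_of_realises (κ : ℝ≥0) {D : DobrushinDomain} {past : CurveClass ℂ}
    (h : past.target ≠ D.pt 1)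
    (hex : ∃ c : SLEConfig, c.Realises (remainingDomain D past) past.target (D.pt 1)) :
    sleMarkovKernel κ D past = sleImageLaw κ hex.choose.ψ (D.pt 1) := by
  unfold sleMarkovKernel
  rw [if_neg h, dif_pos hex]


/-! ### Basic properties of the parametrisation `ψ` of a configuration -/

namespace SLEConfig

variable (c : SLEConfig)

/-- `Φ` is continuous on the closed half-plane (Carathéodory). [cite: PommerenkeBBCM1992, Thm. 2.6] -/
theorem continuousOn_Φ : ContinuousOn c.Φ {z : ℂ | 0 ≤ z.im} := by
  have h := JordanDomain.continuousOn_boundaryExtension_holds c.D.toJordanDomain c.φ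
  rwa [ConformalEquiv.closure_upperHalfPlaneSet_eq] at h

/-- `Φ = φ` on `ℍₒ`. [folklore] -/
theorem Φ_eq_of_mem {z : ℂ} (hz : z ∈ upperHalfPlaneSet) : c.Φ z = c.φ z :=
  c.φ.boundaryExtension_eq hz

/-- `Φ z → b` as `z → ∞` in the closed half-plane. [cite: PommerenkeBBCM1992, Thm. 2.6] -/
theorem tendsto_Φ_cocompact : Tendsto c.Φ (cocompact ℂ ⊓ 𝓟 {z : ℂ | 0 ≤ z.im}) (𝓝 c.tgt) :=
  MarkedDomain.IsChordalUniformizing.tendsto_boundaryExtension_cocompact c.isUnif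

/-- `Φ` never takes the value `b` on the closed half-plane (boundary correspondence). [folklore] -/
theorem Φ_ne_tgt {z : ℂ} (hz : 0 ≤ z.im) : c.Φ z ≠ c.tgt :=
  MarkedDomain.boundaryExtension_ne_pt_one JordanDomain.exists_continuousOn_extension_holds
    c.isUnif hz

/-- `f̄_r` maps the closed half-plane into itself. [folklore] -/
theorem bdryInv_im_nonneg {z : ℂ} (hz : 0 ≤ z.im) : 0 ≤ (Loewner.bdryInv c.W c.r z).im := by
  have h := c.isGeneratedByCurve.bdryInv_mem_closure c.contW c.r hz
  have hsub : closure (Loewner.domain c.W c.r) ⊆ closure upperHalfPlaneSet :=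
    closure_mono Set.sdiff_subset
  exact mem_closure_upperHalfPlaneSet_iff.1 (hsub h)

/-- The shifted argument `projH w + W r` lies in the closed half-plane. [folklore] -/
theorem projH_add_im_nonneg (w : ℂ) : 0 ≤ (projH w + c.W c.r).im := by
  simp only [add_im, ofReal_im, add_zero]
  exact projH_im_nonneg w

/-- **`ψ` is continuous on `ℂ`.** [folklore] -/
theorem continuous_ψ : Continuous c.ψ := by
  have h1 : Continuous fun w : ℂ ↦ projH w + c.W c.r := continuous_projH.add continuous_const
  have h2 : Continuous fun w : ℂ ↦ Loewner.bdryInv c.W c.r (projH w + c.W c.r) :=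
    (c.isGeneratedByCurve.continuousOn_bdryInv c.contW c.r).comp_continuous h1
      fun w ↦ c.projH_add_im_nonneg w
  exact c.continuousOn_Φ.comp_continuous h2 fun w ↦ c.bdryInv_im_nonneg (c.projH_add_im_nonneg w)

/-- `ψ` is Borel measurable. [folklore] -/
theorem measurable_ψ : Measurable c.ψ := c.continuous_ψ.measurable

/-- The formula for `ψ` on the closed half-plane (no projection). [folklore] -/
theorem ψ_apply_of_im_nonneg {w : ℂ} (hw : 0 ≤ w.im) :
    c.ψ w = c.Φ (Loewner.bdryInv c.W c.r (w + c.W c.r)) := by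
  rw [ψ, projH_of_im_nonneg hw]

/-- A point of `ℍₒ` shifted by the (real) driving value is in `ℍₒ`. [folklore] -/
theorem add_driving_mem {w : ℂ} (hw : w ∈ upperHalfPlaneSet) : w + c.W c.r ∈ upperHalfPlaneSet := by
  change 0 < (w + c.W c.r).im
  simpa using (show 0 < w.im from hw)

/-- The formula for `ψ` on `ℍₒ`: `ψ w = φ (f_r (w + W r))`. [folklore] -/
theorem ψ_apply_of_mem {w : ℂ} (hw : w ∈ upperHalfPlaneSet) :
    c.ψ w = c.φ (Loewner.loewnerInv c.W c.r (w + c.W c.r)) := by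
  have hw' := c.add_driving_mem hw
  rw [c.ψ_apply_of_im_nonneg (le_of_lt hw), Loewner.bdryInv_eq_of_mem c.contW c.r hw',
    c.Φ_eq_of_mem (Loewner.loewnerInv_mem_domain c.contW c.r hw').1]

/-- **`ψ 0` is the tip.** [cite: Lawler2005, Prop. 4.31] -/
theorem ψ_zero : c.ψ 0 = c.tip := by
  rw [c.ψ_apply_of_im_nonneg le_rfl, zero_add, c.isGeneratedByCurve.bdryInv_driving c.contW c.r]
  rfl

/-- The remaining domain is `φ (H_r)`. [folklore] -/
theorem dom_eq : c.dom = c.φ '' Loewner.domain c.W c.r := by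
  refine image_congr fun z hz ↦ c.Φ_eq_of_mem hz.1

/-- The remaining domain is contained in the carrier of `D`. [folklore] -/
theorem dom_subset : c.dom ⊆ c.D.carrier := by
  rw [c.dom_eq]
  rintro _ ⟨z, hz, rfl⟩
  exact c.φ.mapsTo hz.1

/-- `ψ` maps `ℍₒ` into the remaining domain. [folklore] -/
theorem ψ_mapsTo : MapsTo c.ψ upperHalfPlaneSet c.dom := by
  intro w hw
  rw [c.ψ_apply_of_mem hw, c.dom_eq]
  exact mem_image_of_mem _ (Loewner.loewnerInv_mem_domain c.contW c.r (c.add_driving_mem hw))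

/-- **`ψ` never takes the value `b` on the closed half-plane.** [folklore] -/
theorem ψ_ne_tgt {w : ℂ} (hw : 0 ≤ w.im) : c.ψ w ≠ c.tgt := by
  rw [c.ψ_apply_of_im_nonneg hw]
  exact c.Φ_ne_tgt (c.bdryInv_im_nonneg (by simpa using hw))

/-! ### `ψ` as a conformal equivalence `ℍₒ → dom` -/

/-- **`ψ` is a conformal equivalence of `ℍₒ` onto the remaining domain**, with inverse
`v ↦ g_r (φ⁻¹ v) - W r`. [cite: Lawler2005, §6.2] -/
def conf : ConformalEquiv upperHalfPlaneSet c.dom where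
  toPartialEquiv :=
    { toFun := c.ψ
      invFun := fun v ↦ Loewner.map c.W c.r (c.φ.symm v) - c.W c.r
      source := upperHalfPlaneSet
      target := c.dom
      map_source' := fun w hw ↦ c.ψ_mapsTo hw
      map_target' := by
        intro v hv
        rw [c.dom_eq] at hv
        obtain ⟨u, hu, rfl⟩ := hv
        rw [c.φ.symm_apply_apply hu.1]
        change 0 < (Loewner.map c.W c.r u - c.W c.r).im
        simpa using (show 0 < (Loewner.map c.W c.r u).im from Loewner.mapsTo_map c.contW c.r hu)
      left_inv' := by
        intro w hw
        have hw' := c.add_driving_mem hw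
        change Loewner.map c.W c.r (c.φ.symm (c.ψ w)) - c.W c.r = w
        rw [c.ψ_apply_of_mem hw,
          c.φ.symm_apply_apply (Loewner.loewnerInv_mem_domain c.contW c.r hw').1,
          Loewner.map_loewnerInv c.contW c.r hw', add_sub_cancel_right]
      right_inv' := by
        intro v hv
        rw [c.dom_eq] at hv
        obtain ⟨u, hu, rfl⟩ := hv
        have hgu : Loewner.map c.W c.r u ∈ upperHalfPlaneSet := Loewner.mapsTo_map c.contW c.r hu
        have hmem : Loewner.map c.W c.r u - c.W c.r ∈ upperHalfPlaneSet := by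
          change 0 < (Loewner.map c.W c.r u - c.W c.r).im
          simpa using (show 0 < (Loewner.map c.W c.r u).im from hgu)
        rw [c.φ.symm_apply_apply hu.1, c.ψ_apply_of_mem hmem, sub_add_cancel,
          Loewner.loewnerInv_map c.contW hu] }
  source_eq := rfl
  target_eq := rfl
  differentiableOn := by
    change DifferentiableOn ℂ c.ψ upperHalfPlaneSet
    have h : EqOn c.ψ (fun w ↦ c.φ (Loewner.loewnerInv c.W c.r (w + c.W c.r))) upperHalfPlaneSet :=
      fun w hw ↦ c.ψ_apply_of_mem hw
    refine DifferentiableOn.congr ?_ h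
    have h1 : DifferentiableOn ℂ (fun w : ℂ ↦ w + c.W c.r) upperHalfPlaneSet := by fun_prop
    have h2 : MapsTo (fun w : ℂ ↦ w + c.W c.r) upperHalfPlaneSet upperHalfPlaneSet :=
      fun w hw ↦ c.add_driving_mem hw
    have h3 : MapsTo (Loewner.loewnerInv c.W c.r) upperHalfPlaneSet upperHalfPlaneSet :=
      fun w hw ↦ (Loewner.loewnerInv_mem_domain c.contW c.r hw).1
    exact (c.φ.differentiableOn_coe.comp (Loewner.differentiableOn_invFunOn_map c.contW c.r) h3).comp
      h1 h2
  differentiableOn_symm := by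
    change DifferentiableOn ℂ (fun v ↦ Loewner.map c.W c.r (c.φ.symm v) - c.W c.r) c.dom
    have h1 : DifferentiableOn ℂ c.φ.symm c.dom := c.φ.symm.differentiableOn_coe.mono c.dom_subset
    have h2 : MapsTo c.φ.symm c.dom (Loewner.domain c.W c.r) := by
      intro v hv
      rw [c.dom_eq] at hv
      obtain ⟨u, hu, rfl⟩ := hv
      rwa [c.φ.symm_apply_apply hu.1]
    exact ((Loewner.differentiableOn_map c.contW c.r).comp h1 h2).sub_const _

/-- `conf` acts as `ψ`. [folklore] -/
@[simp] theorem conf_apply (w : ℂ) : c.conf w = c.ψ w := rfl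

end SLEConfig

end Literature.Probability.RandomPlanarGeometry

end
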